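import Summits.HodgeConjecture.CorCM.Census.QuarticInversionEquivariance

/-!
# The quartic inversion twists, XIV: the value vector of a vector, values on translates, and the slot binomials

COR-CM (cell `pub-hodgecm2`, stage 2 of the Hodge ladder), count-neutral KERNEL COMBINATORICS by the binder seat b23 (gen 44; claim
QUARTIC-INVERSION, HOME/INBOX.md l.12829).  Part XIV of the lane `Census/QuarticInversion*`, on top of parts I–XIII, all BY NAME.  Bookkeeping
definitions with bodies (`Idx`, `Avec`, `ind₁`, `binVec`, `qY`, `qT`) + theorems; no `Prop`-valued definition, no `decide` beyond closed identities
in `Bool`/`Fin 4`, no certificate, no named fact, no geometry, no `sorry`.  `Interfaces.lean` (C1), every E term, B01, `Transposition/*`,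
`PortJoin/*` untouched.
HONEST FRAMING: `HC_CM` is NOT proved, here or anywhere in the tree; nothing here is a period, a count of record or a headline.

CONTENT (`|B|` odd).
* §1 **The value vector** `Avec v : Idx → ℤ` of a vector `v ∈ ℤ[Ty₄]`, `Idx = (Fin 4 × patterns × B) ⊕ patterns`: the values of all atom
  functionals `fnl (wA j η s) v` and all constant functionals `fnl (wC η) v` (a `ℤ`-linear map).
* §2 **Values on translates** (from part XIII): `fnl (wA j η s) (g·v) = ± fnl (wA j* η* s*) v`, `fnl (wC η) (g·v) = ± fnl (wC η*) v` for
  `g ∈ H₀`, `y`, `t`, with explicit `j*, η*, s*` and signs.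
* §3 **The slot binomials** `binVec j h h' u`: the value vector with `[η = h off j] − [η = h' off j]` at the atom indices `(j, η, u)` and `0`
  elsewhere; antisymmetry and the cocycle `binVec j h h' u + binVec j h' h'' u = binVec j h h'' u`.
* §4 **Transport of binomials**: if `Avec v = binVec j h h' u` then `Avec ((0,σ)·v) = binVec j h h' (u − σ)`,
  `Avec (y·v) = binVec (σY j) (qY h^♯) (qY h'^♯) (−u)` and `Avec (t·v) = binVec (σT j) (qT h^♯) (qT h'^♯) u` (patterns moved by the pattern maps
  `qY ζ`, `qT`, complemented-and-swapped on the masks) — so a submodule containing the value vectors of all translates of `v` contains a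
  binomial at every slot and at the moved coordinates.  All [folklore].

## References
* [Pohlmann1968] H. Pohlmann, Algebraic cycles on abelian varieties of complex multiplication type, Ann. of Math. 88 (1968), Thm 1.
-/

namespace Summit.HodgeConjecture.CorCM.Census.QuarticInversion

open Finset
open Summit.HodgeConjecture.CorCM.Census.OddSliceFacesModel

noncomputable section

variable (A : Type) [AddCommGroup A] [Fintype A] [DecidableEq A]

/-! ## §1 The value vector -/

/-- **The index set of the functionals**: atom indices `(j, η, s)` and constant indices `η`. [folklore] -/
abbrev Idx : Type := (Fin 4 × (Fin 4 → Bool) × A) ⊕ (Fin 4 → Bool)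

/-- The value of the functional with index `i` on `v`. [folklore] -/
def valAt (v : Ty₄ A → ℤ) : Idx A → ℤ
  | Sum.inl ⟨j, η, s⟩ => fnl A (wA A j η s) v
  | Sum.inr η => fnl A (wC A η) v

/-- **The value vector** `v ↦ (fnl w v)_w`, a `ℤ`-linear map `ℤ[Ty₄] → ℤ^Idx`. [folklore] -/
def Avec : (Ty₄ A → ℤ) →ₗ[ℤ] (Idx A → ℤ) where
  toFun := valAt A
  map_add' v v' := by
    funext i
    rcases i with ⟨j, η, s⟩ | η <;> simp only [valAt, map_add, Pi.add_apply]
  map_smul' n v := by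
    funext i
    rcases i with ⟨j, η, s⟩ | η <;> simp only [valAt, map_smul, Pi.smul_apply, RingHom.id_apply]

omit [AddCommGroup A] in
/-- Atom coordinates of the value vector. [folklore] -/
@[simp] theorem Avec_inl (v : Ty₄ A → ℤ) (j : Fin 4) (η : Fin 4 → Bool) (s : A) :
    Avec A v (Sum.inl (j, η, s)) = fnl A (wA A j η s) v := rfl

omit [AddCommGroup A] in
/-- Constant coordinates of the value vector. [folklore] -/
@[simp] theorem Avec_inr (v : Ty₄ A → ℤ) (η : Fin 4 → Bool) : Avec A v (Sum.inr η) = fnl A (wC A η) v := rfl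

/-! ## §2 Values on translates -/

/-- **Atom values on an `H₀`-translate.** [folklore] -/
theorem fnl_wA_translH₄ (hA : Odd (Fintype.card A)) (g : ZMod 2 × A) (j : Fin 4) (η : Fin 4 → Bool) (s : A) (v : Ty₄ A → ℤ) :
    fnl A (wA A j η s) (translH₄ A g v) = if g.1 = 1 then -fnl A (wA A j η (s + g.2)) v else fnl A (wA A j η (s + g.2)) v := by
  rw [fnl_translH₄]
  by_cases h : g.1 = 1
  · have hw : (wA A j η s ∘ twH₄ A g) = (wA A j η (s + g.2) ∘ conj₄ A) := by
      funext Θ; simp only [Function.comp, wA_twH₄ A hA, if_pos h]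
    rw [if_pos h, hw, fnl_comp_conj₄]
  · have hw : (wA A j η s ∘ twH₄ A g) = wA A j η (s + g.2) := by
      funext Θ; simp only [Function.comp, wA_twH₄ A hA, if_neg h]
    rw [if_neg h, hw]

/-- **Atom values on a `y`-translate.** [folklore] -/
theorem fnl_wA_translY (hA : Odd (Fintype.card A)) (ζ : ZMod 2) (j : Fin 4) (η : Fin 4 → Bool) (s : A) (v : Ty₄ A → ℤ) :
    fnl A (wA A j η s) (translY A ζ v) =
      if bY ζ j then -fnl A (wA A (σY j) (fun n => !pY ζ η n) (-s)) v else fnl A (wA A (σY j) (pY ζ η) (-s)) v := by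
  rw [fnl_translY]
  cases hb : bY ζ j
  · have hw : (wA A j η s ∘ twY A ζ) = wA A (σY j) (pY ζ η) (-s) := by
      funext Θ; simp only [Function.comp, wA_twY A hA, hb]; rfl
    rw [if_neg (by decide), hw]
  · have hw : (wA A j η s ∘ twY A ζ) = (wA A (σY j) (fun n => !pY ζ η n) (-s) ∘ conj₄ A) := by
      funext Θ; simp only [Function.comp, wA_twY A hA, hb, if_true]
    rw [if_pos rfl, hw, fnl_comp_conj₄]

/-- **Atom values on a `t`-translate.** [folklore] -/
theorem fnl_wA_translT (hA : Odd (Fintype.card A)) (j : Fin 4) (η : Fin 4 → Bool) (s : A) (v : Ty₄ A → ℤ) :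
    fnl A (wA A j η s) (translT A v) =
      if bT j then -fnl A (wA A (σT j) (fun n => !pT η n) s) v else fnl A (wA A (σT j) (pT η) s) v := by
  rw [fnl_translT]
  cases hb : bT j
  · have hw : (wA A j η s ∘ twT A) = wA A (σT j) (pT η) s := by
      funext Θ; simp only [Function.comp, wA_twT A hA, hb]; rfl
    rw [if_neg (by decide), hw]
  · have hw : (wA A j η s ∘ twT A) = (wA A (σT j) (fun n => !pT η n) s ∘ conj₄ A) := by
      funext Θ; simp only [Function.comp, wA_twT A hA, hb, if_true]
    rw [if_pos rfl, hw, fnl_comp_conj₄]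

/-- **Constant values on an `H₀`-translate.** [folklore] -/
theorem fnl_wC_translH₄ (hA : Odd (Fintype.card A)) (g : ZMod 2 × A) (η : Fin 4 → Bool) (v : Ty₄ A → ℤ) :
    fnl A (wC A η) (translH₄ A g v) = if g.1 = 1 then -fnl A (wC A η) v else fnl A (wC A η) v := by
  rw [fnl_translH₄]
  by_cases h : g.1 = 1
  · have hw : (wC A η ∘ twH₄ A g) = (wC A η ∘ conj₄ A) := by
      funext Θ; simp only [Function.comp, wC_twH₄ A hA, if_pos h]
    rw [if_pos h, hw, fnl_comp_conj₄]
  · have hw : (wC A η ∘ twH₄ A g) = wC A η := by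
      funext Θ; simp only [Function.comp, wC_twH₄ A hA, if_neg h]
    rw [if_neg h, hw]

/-- **Constant values on a `y`-translate.** [folklore] -/
theorem fnl_wC_translY (hA : Odd (Fintype.card A)) (ζ : ZMod 2) (η : Fin 4 → Bool) (v : Ty₄ A → ℤ) :
    fnl A (wC A η) (translY A ζ v) = fnl A (wC A (pY ζ η)) v := by
  have hw : (wC A η ∘ twY A ζ) = wC A (pY ζ η) := by
    funext Θ; simp only [Function.comp, wC_twY A hA]
  rw [fnl_translY, hw]

/-- **Constant values on a `t`-translate.** [folklore] -/
theorem fnl_wC_translT (hA : Odd (Fintype.card A)) (η : Fin 4 → Bool) (v : Ty₄ A → ℤ) :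
    fnl A (wC A η) (translT A v) = fnl A (wC A (pT η)) v := by
  have hw : (wC A η ∘ twT A) = wC A (pT η) := by
    funext Θ; simp only [Function.comp, wC_twT A hA]
  rw [fnl_translT, hw]

/-! ## §3 The slot binomials -/

/-- `[η follows h off j]` as an integer. [folklore] -/
def ind₁ (j : Fin 4) (h η : Fin 4 → Bool) : ℤ := if ∀ n, n ≠ j → η n = h n then 1 else 0

/-- **The slot binomial** between the patterns `h, h'` of the atom coordinate `j` at the slot `u`. [folklore] -/
def binVec (j : Fin 4) (h h' : Fin 4 → Bool) (u : A) : Idx A → ℤ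
  | Sum.inl ⟨j', η, s⟩ => if j' = j ∧ s = u then ind₁ j h η - ind₁ j h' η else 0
  | Sum.inr _ => 0

omit [AddCommGroup A] [Fintype A] in
/-- Atom coordinates of a binomial. [folklore] -/
theorem binVec_inl (j : Fin 4) (h h' : Fin 4 → Bool) (u : A) (j' : Fin 4) (η : Fin 4 → Bool) (s : A) :
    binVec A j h h' u (Sum.inl (j', η, s)) = if j' = j ∧ s = u then ind₁ j h η - ind₁ j h' η else 0 := rfl

omit [AddCommGroup A] [Fintype A] in
/-- Constant coordinates of a binomial vanish. [folklore] -/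
@[simp] theorem binVec_inr (j : Fin 4) (h h' : Fin 4 → Bool) (u : A) (η : Fin 4 → Bool) : binVec A j h h' u (Sum.inr η) = 0 := rfl

omit [AddCommGroup A] [Fintype A] in
/-- The trivial binomial. [folklore] -/
@[simp] theorem binVec_self (j : Fin 4) (h : Fin 4 → Bool) (u : A) : binVec A j h h u = 0 := by
  funext i
  rcases i with ⟨j', η, s⟩ | η
  · rw [binVec_inl, sub_self, ite_self, Pi.zero_apply]
  · rfl

omit [AddCommGroup A] [Fintype A] in
/-- **Antisymmetry.** [folklore] -/
theorem binVec_swap (j : Fin 4) (h h' : Fin 4 → Bool) (u : A) : binVec A j h' h u = -binVec A j h h' u := by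
  funext i
  rcases i with ⟨j', η, s⟩ | η
  · rw [Pi.neg_apply, binVec_inl, binVec_inl]
    split_ifs <;> ring
  · rw [Pi.neg_apply, binVec_inr, binVec_inr, neg_zero]

omit [AddCommGroup A] [Fintype A] in
/-- **The cocycle**: `binVec j h h' u + binVec j h' h'' u = binVec j h h'' u`. [folklore] -/
theorem binVec_add_binVec (j : Fin 4) (h h' h'' : Fin 4 → Bool) (u : A) :
    binVec A j h h' u + binVec A j h' h'' u = binVec A j h h'' u := by
  funext i
  rcases i with ⟨j', η, s⟩ | η
  · rw [Pi.add_apply, binVec_inl, binVec_inl, binVec_inl]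
    split_ifs <;> ring
  · rw [Pi.add_apply, binVec_inr, binVec_inr, binVec_inr, add_zero]

omit [AddCommGroup A] [Fintype A] [DecidableEq A] in
/-- The indicator only reads the pattern off `j`. [folklore] -/
theorem ind₁_congr {j : Fin 4} {h₁ h₂ : Fin 4 → Bool} (hh : ∀ n, n ≠ j → h₁ n = h₂ n) (η : Fin 4 → Bool) :
    ind₁ j h₁ η = ind₁ j h₂ η := by
  unfold ind₁
  have key : (∀ n, n ≠ j → η n = h₁ n) ↔ (∀ n, n ≠ j → η n = h₂ n) := by
    constructor
    · intro H n hn; rw [H n hn, hh n hn]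
    · intro H n hn; rw [H n hn, ← hh n hn]
  simp only [key]

omit [AddCommGroup A] [Fintype A] in
/-- Binomials only read the patterns off `j`. [folklore] -/
theorem binVec_congr {j : Fin 4} {h₁ h₂ h₁' h₂' : Fin 4 → Bool} (hh : ∀ n, n ≠ j → h₁ n = h₂ n) (hh' : ∀ n, n ≠ j → h₁' n = h₂' n)
    (u : A) : binVec A j h₁ h₁' u = binVec A j h₂ h₂' u := by
  funext i
  rcases i with ⟨j', η, s⟩ | η
  · rw [binVec_inl, binVec_inl, ind₁_congr hh, ind₁_congr hh']
  · rfl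

/-! ## §4 Transport of binomials -/

/-- The pattern map of `y` on the target side: `(qY ζ h) n = h (σY n) ⊻ bY ζ n`. [folklore] -/
def qY (ζ : ZMod 2) (h : Fin 4 → Bool) : Fin 4 → Bool := fun n => xor (h (σY n)) (bY ζ n)

/-- The pattern map of `t` on the target side: `(qT h) n = h (σT n) ⊻ bT n`. [folklore] -/
def qT (h : Fin 4 → Bool) : Fin 4 → Bool := fun n => xor (h (σT n)) (bT n)

omit [AddCommGroup A] [Fintype A] [DecidableEq A] in
/-- **The indicator under a permutation-with-mask**: `[pη = h off j] = [η = qh off σ j]`. [folklore] -/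
theorem ind₁_perm {σ : Fin 4 → Fin 4} (hσ : ∀ n, σ (σ n) = n) (β : Fin 4 → Bool) (j : Fin 4) (h η : Fin 4 → Bool) :
    ind₁ j h (fun n => xor (η (σ n)) (β (σ n))) = ind₁ (σ j) (fun n => xor (h (σ n)) (β n)) η := by
  have hx : ∀ a b c : Bool, (xor a b = c) ↔ (a = xor c b) := by decide
  have key : (∀ n, n ≠ j → xor (η (σ n)) (β (σ n)) = h n) ↔ (∀ n, n ≠ σ j → η n = xor (h (σ n)) (β n)) := by
    constructor
    · intro H n hn
      have hne : σ n ≠ j := fun e => hn (by rw [← e, hσ])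
      have := H (σ n) hne
      rw [hσ, hx] at this
      exact this
    · intro H n hn
      have hne : σ n ≠ σ j := fun e => hn (by rw [← hσ n, e, hσ])
      have := H (σ n) hne
      rw [hσ] at this
      rw [hx]; exact this
  unfold ind₁
  simp only [key]

omit [AddCommGroup A] [Fintype A] [DecidableEq A] in
/-- The indicator of a complemented moved pattern. [folklore] -/
theorem ind₁_perm_not {σ : Fin 4 → Fin 4} (hσ : ∀ n, σ (σ n) = n) (β : Fin 4 → Bool) (j : Fin 4) (h η : Fin 4 → Bool) :
    ind₁ j h (fun n => !xor (η (σ n)) (β (σ n))) = ind₁ (σ j) (fun n => xor (!h (σ n)) (β n)) η := by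
  have e1 : ind₁ j h (fun n => !xor (η (σ n)) (β (σ n))) = ind₁ j (fun n => !h n) (fun n => xor (η (σ n)) (β (σ n))) := by
    unfold ind₁
    have key : (∀ n, n ≠ j → (!xor (η (σ n)) (β (σ n))) = h n) ↔ (∀ n, n ≠ j → xor (η (σ n)) (β (σ n)) = !h n) := by
      constructor
      · intro H n hn; rw [← H n hn, Bool.not_not]
      · intro H n hn; rw [H n hn, Bool.not_not]
    simp only [key]
  rw [e1, ind₁_perm hσ β j]

/-- **Transport by `(0,σ) ∈ H₀`**: the slot shifts. [folklore] -/
theorem Avec_translH₄_of_binVec (hA : Odd (Fintype.card A)) (σ : A) {v : Ty₄ A → ℤ} {j : Fin 4} {h h' : Fin 4 → Bool} {u : A}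
    (hv : Avec A v = binVec A j h h' u) : Avec A (translH₄ A (0, σ) v) = binVec A j h h' (u - σ) := by
  funext i
  rcases i with ⟨j', η, s⟩ | η
  · rw [Avec_inl, fnl_wA_translH₄ A hA, if_neg (fun e => zero_ne_one e), ← Avec_inl, hv, binVec_inl, binVec_inl]
    have hs : (s + σ = u) ↔ (s = u - σ) := eq_sub_iff_add_eq.symm
    simp only [hs]
  · rw [Avec_inr, fnl_wC_translH₄ A hA, if_neg (fun e => zero_ne_one e), ← Avec_inr, hv, binVec_inr, binVec_inr]

/-- **Transport by `y`**: coordinate `σY j`, slot `−u`, patterns moved by `qY ζ` (complemented and swapped on the mask). [folklore] -/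
theorem Avec_translY_of_binVec (hA : Odd (Fintype.card A)) (ζ : ZMod 2) {v : Ty₄ A → ℤ} {j : Fin 4} {h h' : Fin 4 → Bool} {u : A}
    (hv : Avec A v = binVec A j h h' u) :
    Avec A (translY A ζ v) =
      if bY ζ (σY j) then binVec A (σY j) (qY ζ (fun n => !h' n)) (qY ζ (fun n => !h n)) (-u)
      else binVec A (σY j) (qY ζ h) (qY ζ h') (-u) := by
  funext i
  rcases i with ⟨j', η, s⟩ | η
  · rw [Avec_inl, fnl_wA_translY A hA]
    have hs : (-s = u) ↔ (s = -u) := neg_eq_iff_eq_neg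
    have hj : (σY j' = j) ↔ (j' = σY j) := by
      constructor
      · intro e; rw [← e, σY_σY]
      · intro e; rw [e, σY_σY]
    by_cases hb : bY ζ j' = true
    · rw [if_pos hb, ← Avec_inl, hv, binVec_inl]
      by_cases hc : σY j' = j ∧ -s = u
      · obtain ⟨hc1, hc2⟩ := hc
        have hb' : bY ζ (σY j) = true := by rw [← hc1, σY_σY]; exact hb
        rw [if_pos ⟨hc1, hc2⟩, if_pos hb', binVec_inl, if_pos ⟨hj.mp hc1, hs.mp hc2⟩, ← hc1]
        show -(ind₁ (σY j') h (fun n => !pY ζ η n) - ind₁ (σY j') h' (fun n => !pY ζ η n)) = _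
        unfold pY
        rw [ind₁_perm_not σY_σY, ind₁_perm_not σY_σY, σY_σY]
        show -(ind₁ j' (qY ζ fun n => !h n) η - ind₁ j' (qY ζ fun n => !h' n) η) = _
        ring
      · rw [if_neg hc, neg_zero]
        have hc' : ¬ (j' = σY j ∧ s = -u) := fun ⟨e1, e2⟩ => hc ⟨hj.mpr e1, hs.mpr e2⟩
        split_ifs with hb'
        · rw [binVec_inl, if_neg hc']
        · rw [binVec_inl, if_neg hc']
    · rw [if_neg hb, ← Avec_inl, hv, binVec_inl]
      by_cases hc : σY j' = j ∧ -s = u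
      · obtain ⟨hc1, hc2⟩ := hc
        have hb' : ¬ bY ζ (σY j) = true := by rw [← hc1, σY_σY]; exact hb
        rw [if_pos ⟨hc1, hc2⟩, if_neg hb', binVec_inl, if_pos ⟨hj.mp hc1, hs.mp hc2⟩, ← hc1]
        unfold pY
        rw [ind₁_perm σY_σY, ind₁_perm σY_σY, σY_σY]
        rfl
      · rw [if_neg hc]
        have hc' : ¬ (j' = σY j ∧ s = -u) := fun ⟨e1, e2⟩ => hc ⟨hj.mpr e1, hs.mpr e2⟩
        split_ifs with hb'
        · rw [binVec_inl, if_neg hc']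
        · rw [binVec_inl, if_neg hc']
  · rw [Avec_inr, fnl_wC_translY A hA, ← Avec_inr, hv, binVec_inr]
    split_ifs <;> rw [binVec_inr]

/-- **Transport by `t`**: coordinate `σT j`, same slot, patterns moved by `qT` (complemented and swapped on the mask). [folklore] -/
theorem Avec_translT_of_binVec (hA : Odd (Fintype.card A)) {v : Ty₄ A → ℤ} {j : Fin 4} {h h' : Fin 4 → Bool} {u : A}
    (hv : Avec A v = binVec A j h h' u) :
    Avec A (translT A v) =
      if bT (σT j) then binVec A (σT j) (qT (fun n => !h' n)) (qT (fun n => !h n)) u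
      else binVec A (σT j) (qT h) (qT h') u := by
  funext i
  rcases i with ⟨j', η, s⟩ | η
  · rw [Avec_inl, fnl_wA_translT A hA]
    have hj : (σT j' = j) ↔ (j' = σT j) := by
      constructor
      · intro e; rw [← e, σT_σT]
      · intro e; rw [e, σT_σT]
    by_cases hb : bT j' = true
    · rw [if_pos hb, ← Avec_inl, hv, binVec_inl]
      by_cases hc : σT j' = j ∧ s = u
      · obtain ⟨hc1, hc2⟩ := hc
        have hb' : bT (σT j) = true := by rw [← hc1, σT_σT]; exact hb
        rw [if_pos ⟨hc1, hc2⟩, if_pos hb', binVec_inl, if_pos ⟨hj.mp hc1, hc2⟩, ← hc1]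
        show -(ind₁ (σT j') h (fun n => !pT η n) - ind₁ (σT j') h' (fun n => !pT η n)) = _
        unfold pT
        rw [ind₁_perm_not σT_σT, ind₁_perm_not σT_σT, σT_σT]
        show -(ind₁ j' (qT fun n => !h n) η - ind₁ j' (qT fun n => !h' n) η) = _
        ring
      · rw [if_neg hc, neg_zero]
        have hc' : ¬ (j' = σT j ∧ s = u) := fun ⟨e1, e2⟩ => hc ⟨hj.mpr e1, e2⟩
        split_ifs with hb'
        · rw [binVec_inl, if_neg hc']
        · rw [binVec_inl, if_neg hc']
    · rw [if_neg hb, ← Avec_inl, hv, binVec_inl]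
      by_cases hc : σT j' = j ∧ s = u
      · obtain ⟨hc1, hc2⟩ := hc
        have hb' : ¬ bT (σT j) = true := by rw [← hc1, σT_σT]; exact hb
        rw [if_pos ⟨hc1, hc2⟩, if_neg hb', binVec_inl, if_pos ⟨hj.mp hc1, hc2⟩, ← hc1]
        unfold pT
        rw [ind₁_perm σT_σT, ind₁_perm σT_σT, σT_σT]
        rfl
      · rw [if_neg hc]
        have hc' : ¬ (j' = σT j ∧ s = u) := fun ⟨e1, e2⟩ => hc ⟨hj.mpr e1, e2⟩
        split_ifs with hb'
        · rw [binVec_inl, if_neg hc']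
        · rw [binVec_inl, if_neg hc']
  · rw [Avec_inr, fnl_wC_translT A hA, ← Avec_inr, hv, binVec_inr]
    split_ifs <;> rw [binVec_inr]

end

end Summit.HodgeConjecture.CorCM.Census.QuarticInversion
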